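import Mathlib
import HarnessLib
import Summits.ResolutionOfSingularities.ResolutionOfSingularities.Theorems.WildQuotientsWildQuotientResolutionJordanFiveLociW1
import Summits.ResolutionOfSingularities.ResolutionOfSingularities.Theorems.WildQuotientsWildQuotientResolutionJordanFiveChartW2Defs

/-!
# RUNG V5 (`J₅`), loci at `W₂ = chartW₂ = D₊(i₂³t · (2j₃)²t)`: `HB₂`, `HA₂`, and the congruences
# `i₂³t ≡ x_c⁶t`, `(2j₃)²t ≡ 4·x_c⁶t` behind `C_c ⊆ W₂` and `Hcov`
(crux stmt-ResolutionOfSingularities-15640 `WildQuotients.WildQuotientResolution`, line `Sketch`;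
chain w45c RUNG V5 `JordanFive.jordanFive_hasResolution_of_bricks` (res-L1-w45c-lead-1 BRICK LIST v1
`stubs/J5Bricks.lean` l.117–118: `HB₂ : Disjoint (vertexCurve 1) ↑W₂`, `HA₂ : Disjoint (vertexCurve 0)
↑W₂`), res-L1-w45c-plan-1 RULING 10:50Z «stub-5 = (δ1) … + loci», W₂ DESIGN = res-L1-w45c-idea-2
(W2-DESIGN.md 400ebbeeb3422d46 §4), W₂ TERM = res-L1-w45c-stub-1's `chartW₂` (p528290); written by
res-D-pv-033 AS res-L1-w45c-stub-5. [OURS · L1 W4.5c] — Rees-algebra bookkeeping; NOT a statement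
of any manuscript.)

MECHANISM (idea-2 §4, the J₄ `HC₀W` pattern): res-L1-w45c-stub-1's certificates `i₂³ = Σ c_j g_j`
(generators `j ∈ {0,2,4,5,8,9,10,13,18,19,20,21,24,34,36,38}` — NO `g₁`) and `(2j₃)² = Σ c′_j g_j`
(`j ∈ {1,2,4,5,6,7,8,9,10,11,13,14,18,20,21,24,34,35,36,37,38,39}` — NO `g₀`), from p528290, read in degree
one of `k[x][I₁₂t]` (`reesT_iTwo_cube_eq`, `reesT_jThreeTwo_sq_eq`). Off the charts `j ≠ 1` (the
`μ₃`-vertex curve `C_b`) every `g_j t`, `j ≠ 1`, lies in `𝔭_v`, hence `i₂³t ∈ 𝔭_v` and `v ∉ chartW₂`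
(**`HB₂`**); off the charts `j ≠ 0` (`C_a`) likewise `(2j₃)²t ∈ 𝔭_v` (**`HA₂`**). The only generator in
`k[x_c]` is `g₂ = x_c⁶`, with coefficient `1` resp. `4`: modulo the sections `g_j t`, `j ≠ 2`,
`i₂³t ≡ g₂t` and `(2j₃)²t ≡ 4·g₂t` (`reesT_two_mem_of_iTwo_cube_mem`,
`reesT_two_mem_of_jThreeTwo_sq_mem`, the latter for `(2 : k) ≠ 0`) — the input of
**`vertexCurve_two_subset_chartW₂` (`C_c ⊆ W₂`)** and of `Hcov` step (D).
-/

-- single-problem summit: the doubled namespace component `ResolutionOfSingularities` is forced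
set_option linter.dupNamespace false

noncomputable section

open CategoryTheory AlgebraicGeometry TopologicalSpace MvPolynomial Polynomial
open Literature.AlgebraicGeometry.Resolution

namespace Summit.ResolutionOfSingularities.ResolutionOfSingularities.Theorems.WildQuotientResolution.JordanFive

variable (k : Type) [Field k] (n : ℕ) (a b c d e : Fin n)

/-! ## The two certificates in degree one -/

/-- **`i₂³t = g₂t + Σ_{j ≠ 2} c_j · (g_j t)`** (`j ∈ {0,2,4,5,8,9,10,13,18,19,20,21,24,34,36,38}`;
res-L1-w45c-stub-1's certificate for `i₂³ ∈ I₁₂`, p528290, read in the Rees algebra, the `x_c⁶t` term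
isolated). [OURS · L1 W4.5c] [folklore] -/
theorem reesT_iTwo_cube_eq :
    reesT (iTwo k n a b c d e ^ 3) (iTwo_cube_mem_I12 k n a b c d e) =
      reesT (gens12 k n a b c d 2) (gens12_mem_I12 k n a b c d 2) +
        (((8 : MvPolynomial (Fin n) k) * (X e ^ 3) + (36 : MvPolynomial (Fin n) k) * (X d * X e ^ 2) + (54 : MvPolynomial (Fin n) k) * (X d ^ 2 * X e) + (27 : MvPolynomial (Fin n) k) * (X d ^ 3) + (12 : MvPolynomial (Fin n) k) * (X c * X e ^ 2) + (36 : MvPolynomial (Fin n) k) * (X c * X d * X e) + (27 : MvPolynomial (Fin n) k) * (X c * X d ^ 2) + (6 : MvPolynomial (Fin n) k) * (X c ^ 2 * X e) + (9 : MvPolynomial (Fin n) k) * (X c ^ 2 * X d) + (1 : MvPolynomial (Fin n) k) * (X c ^ 3)) •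
          reesT (gens12 k n a b c d 0) (gens12_mem_I12 k n a b c d 0) +
        ((-24 : MvPolynomial (Fin n) k) * (X e ^ 2) + (-72 : MvPolynomial (Fin n) k) * (X d * X e) + (-54 : MvPolynomial (Fin n) k) * (X d ^ 2) + (-60 : MvPolynomial (Fin n) k) * (X c * X e) + (-63 : MvPolynomial (Fin n) k) * (X c * X d) + (-24 : MvPolynomial (Fin n) k) * (X c ^ 2)) •
          reesT (gens12 k n a b c d 4) (gens12_mem_I12 k n a b c d 4) +
        ((12 : MvPolynomial (Fin n) k) * (X e ^ 2) + (36 : MvPolynomial (Fin n) k) * (X d * X e) + (27 : MvPolynomial (Fin n) k) * (X d ^ 2) + (12 : MvPolynomial (Fin n) k) * (X c * X e) + (18 : MvPolynomial (Fin n) k) * (X c * X d) + (3 : MvPolynomial (Fin n) k) * (X c ^ 2) + (-12 : MvPolynomial (Fin n) k) * (X b * X e) + (-3 : MvPolynomial (Fin n) k) * (X b * X c)) •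
          reesT (gens12 k n a b c d 5) (gens12_mem_I12 k n a b c d 5) +
        ((24 : MvPolynomial (Fin n) k) * (X d * X e) + (48 : MvPolynomial (Fin n) k) * (X d ^ 2) + (6 : MvPolynomial (Fin n) k) * (X c * X e) + (21 : MvPolynomial (Fin n) k) * (X c * X d) + (3 : MvPolynomial (Fin n) k) * (X c ^ 2)) •
          reesT (gens12 k n a b c d 8) (gens12_mem_I12 k n a b c d 8) +
        ((24 : MvPolynomial (Fin n) k) * (X e) + (36 : MvPolynomial (Fin n) k) * (X d)) •
          reesT (gens12 k n a b c d 9) (gens12_mem_I12 k n a b c d 9) +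
        ((-24 : MvPolynomial (Fin n) k) * (X e) + (-36 : MvPolynomial (Fin n) k) * (X d) + (-30 : MvPolynomial (Fin n) k) * (X c)) •
          reesT (gens12 k n a b c d 10) (gens12_mem_I12 k n a b c d 10) +
        ((6 : MvPolynomial (Fin n) k) * (X e) + (9 : MvPolynomial (Fin n) k) * (X d) + (3 : MvPolynomial (Fin n) k) * (X c) + (-6 : MvPolynomial (Fin n) k) * (X b)) •
          reesT (gens12 k n a b c d 13) (gens12_mem_I12 k n a b c d 13) +
        ((-12 : MvPolynomial (Fin n) k) * (X d) + (-6 : MvPolynomial (Fin n) k) * (X c)) •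
          reesT (gens12 k n a b c d 18) (gens12_mem_I12 k n a b c d 18) +
        ((-8 : MvPolynomial (Fin n) k) * (1)) •
          reesT (gens12 k n a b c d 19) (gens12_mem_I12 k n a b c d 19) +
        ((12 : MvPolynomial (Fin n) k) * (X d) + (3 : MvPolynomial (Fin n) k) * (X c) + (-1 : MvPolynomial (Fin n) k) * (X b)) •
          reesT (gens12 k n a b c d 20) (gens12_mem_I12 k n a b c d 20) +
        ((12 : MvPolynomial (Fin n) k) * (1)) •
          reesT (gens12 k n a b c d 21) (gens12_mem_I12 k n a b c d 21) +
        ((-6 : MvPolynomial (Fin n) k) * (1)) •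
          reesT (gens12 k n a b c d 24) (gens12_mem_I12 k n a b c d 24) +
        ((-12 : MvPolynomial (Fin n) k) * (X e ^ 2)) •
          reesT (gens12 k n a b c d 34) (gens12_mem_I12 k n a b c d 34) +
        ((-12 : MvPolynomial (Fin n) k) * (X e)) •
          reesT (gens12 k n a b c d 36) (gens12_mem_I12 k n a b c d 36) +
        ((-3 : MvPolynomial (Fin n) k) * (1)) •
          reesT (gens12 k n a b c d 38) (gens12_mem_I12 k n a b c d 38)) := by
  apply Subtype.ext
  simp only [Subalgebra.coe_add, Subalgebra.coe_smul, coe_reesT, Polynomial.smul_monomial,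
    smul_eq_mul, ← map_add]
  congr 1
  simp only [gens12, Matrix.cons_val, iTwo]
  ring

/-- **`(2j₃)²t = 4·g₂t + Σ_{j ≠ 2} c′_j · (g_j t)`** (`j ∈ {1,2,4,5,6,7,8,9,10,11,13,14,18,20,21,24,34,35,36,37,38,39}`;
res-L1-w45c-stub-1's certificate for `(2j₃)² ∈ I₁₂`, p528290, read in the Rees algebra).
[OURS · L1 W4.5c] [folklore] -/
theorem reesT_jThreeTwo_sq_eq :
    reesT (jThreeTwo k n a b c d e ^ 2) (jThreeTwo_sq_mem_I12 k n a b c d e) =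
      (4 : MvPolynomial (Fin n) k) • reesT (gens12 k n a b c d 2) (gens12_mem_I12 k n a b c d 2) +
        (((36 : MvPolynomial (Fin n) k) * (X e ^ 2) + (72 : MvPolynomial (Fin n) k) * (X d * X e) + (36 : MvPolynomial (Fin n) k) * (X d ^ 2) + (12 : MvPolynomial (Fin n) k) * (X c * X e) + (12 : MvPolynomial (Fin n) k) * (X c * X d) + (1 : MvPolynomial (Fin n) k) * (X c ^ 2)) •
          reesT (gens12 k n a b c d 1) (gens12_mem_I12 k n a b c d 1) +
        ((-108 : MvPolynomial (Fin n) k) * (X d * X e) + (-108 : MvPolynomial (Fin n) k) * (X d ^ 2) + (144 : MvPolynomial (Fin n) k) * (X c * X e) + (-18 : MvPolynomial (Fin n) k) * (X c * X d) + (-24 : MvPolynomial (Fin n) k) * (X c ^ 2) + (72 : MvPolynomial (Fin n) k) * (X b * X e) + (36 : MvPolynomial (Fin n) k) * (X b * X d) + (12 : MvPolynomial (Fin n) k) * (X b * X c)) •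
          reesT (gens12 k n a b c d 4) (gens12_mem_I12 k n a b c d 4) +
        ((144 : MvPolynomial (Fin n) k) * (X e ^ 2) + (36 : MvPolynomial (Fin n) k) * (X d ^ 2) + (-48 : MvPolynomial (Fin n) k) * (X c * X e) + (4 : MvPolynomial (Fin n) k) * (X c ^ 2) + (-4 : MvPolynomial (Fin n) k) * (X b * X c) + (1 : MvPolynomial (Fin n) k) * (X b ^ 2)) •
          reesT (gens12 k n a b c d 5) (gens12_mem_I12 k n a b c d 5) +
        ((-216 : MvPolynomial (Fin n) k) * (X e)) •
          reesT (gens12 k n a b c d 6) (gens12_mem_I12 k n a b c d 6) +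
        ((81 : MvPolynomial (Fin n) k) * (1)) •
          reesT (gens12 k n a b c d 7) (gens12_mem_I12 k n a b c d 7) +
        ((-144 : MvPolynomial (Fin n) k) * (X e ^ 2) + (-72 : MvPolynomial (Fin n) k) * (X d * X e) + (90 : MvPolynomial (Fin n) k) * (X d ^ 2) + (36 : MvPolynomial (Fin n) k) * (X c * X e) + (72 : MvPolynomial (Fin n) k) * (X c * X d) + (10 : MvPolynomial (Fin n) k) * (X c ^ 2) + (-24 : MvPolynomial (Fin n) k) * (X b * X e) + (-24 : MvPolynomial (Fin n) k) * (X b * X d) + (-2 : MvPolynomial (Fin n) k) * (X b * X c) + (12 : MvPolynomial (Fin n) k) * (X a * X e)) •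
          reesT (gens12 k n a b c d 8) (gens12_mem_I12 k n a b c d 8) +
        ((108 : MvPolynomial (Fin n) k) * (X e) + (108 : MvPolynomial (Fin n) k) * (X d) + (-72 : MvPolynomial (Fin n) k) * (X b)) •
          reesT (gens12 k n a b c d 9) (gens12_mem_I12 k n a b c d 9) +
        ((144 : MvPolynomial (Fin n) k) * (X e) + (-54 : MvPolynomial (Fin n) k) * (X d) + (-48 : MvPolynomial (Fin n) k) * (X c)) •
          reesT (gens12 k n a b c d 10) (gens12_mem_I12 k n a b c d 10) +
        ((-108 : MvPolynomial (Fin n) k) * (1)) •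
          reesT (gens12 k n a b c d 11) (gens12_mem_I12 k n a b c d 11) +
        ((-48 : MvPolynomial (Fin n) k) * (X e) + (8 : MvPolynomial (Fin n) k) * (X c) + (-16 : MvPolynomial (Fin n) k) * (X b)) •
          reesT (gens12 k n a b c d 13) (gens12_mem_I12 k n a b c d 13) +
        ((36 : MvPolynomial (Fin n) k) * (1)) •
          reesT (gens12 k n a b c d 14) (gens12_mem_I12 k n a b c d 14) +
        ((-72 : MvPolynomial (Fin n) k) * (X e) + (-72 : MvPolynomial (Fin n) k) * (X d) + (-48 : MvPolynomial (Fin n) k) * (X c)) •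
          reesT (gens12 k n a b c d 18) (gens12_mem_I12 k n a b c d 18) +
        ((24 : MvPolynomial (Fin n) k) * (X e) + (60 : MvPolynomial (Fin n) k) * (X d) + (13 : MvPolynomial (Fin n) k) * (X c) + (-6 : MvPolynomial (Fin n) k) * (X b)) •
          reesT (gens12 k n a b c d 20) (gens12_mem_I12 k n a b c d 20) +
        ((36 : MvPolynomial (Fin n) k) * (1)) •
          reesT (gens12 k n a b c d 21) (gens12_mem_I12 k n a b c d 21) +
        ((-24 : MvPolynomial (Fin n) k) * (1)) •
          reesT (gens12 k n a b c d 24) (gens12_mem_I12 k n a b c d 24) +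
        ((144 : MvPolynomial (Fin n) k) * (X e ^ 2)) •
          reesT (gens12 k n a b c d 34) (gens12_mem_I12 k n a b c d 34) +
        ((-72 : MvPolynomial (Fin n) k) * (X e ^ 2) + (-144 : MvPolynomial (Fin n) k) * (X d * X e)) •
          reesT (gens12 k n a b c d 35) (gens12_mem_I12 k n a b c d 35) +
        ((48 : MvPolynomial (Fin n) k) * (X e)) •
          reesT (gens12 k n a b c d 36) (gens12_mem_I12 k n a b c d 36) +
        ((-36 : MvPolynomial (Fin n) k) * (X e)) •
          reesT (gens12 k n a b c d 37) (gens12_mem_I12 k n a b c d 37) +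
        ((-12 : MvPolynomial (Fin n) k) * (1)) •
          reesT (gens12 k n a b c d 38) (gens12_mem_I12 k n a b c d 38) +
        ((36 : MvPolynomial (Fin n) k) * (X e ^ 2)) •
          reesT (gens12 k n a b c d 39) (gens12_mem_I12 k n a b c d 39)) := by
  apply Subtype.ext
  simp only [Subalgebra.coe_add, Subalgebra.coe_smul, coe_reesT, Polynomial.smul_monomial,
    smul_eq_mul, ← map_add]
  congr 1
  simp only [gens12, Matrix.cons_val, jThreeTwo]
  ring

/-! ## Memberships modulo an ideal of the Rees algebra -/

/-- The `j ≠ 2` part of the `i₂³` certificate lies in `𝔭` when its fifteen sections do.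
[OURS · L1 W4.5c] -/
theorem iTwo_cube_rest_mem (𝔭 : Ideal (reesAlgebra (I12 k n a b c d)))
    (h : ∀ j : Fin 40, j = 0 ∨ j = 4 ∨ j = 5 ∨ j = 8 ∨ j = 9 ∨ j = 10 ∨ j = 13 ∨ j = 18 ∨ j = 19 ∨ j = 20 ∨ j = 21 ∨ j = 24 ∨ j = 34 ∨ j = 36 ∨ j = 38 →
      reesT (gens12 k n a b c d j) (gens12_mem_I12 k n a b c d j) ∈ 𝔭) :
    (((8 : MvPolynomial (Fin n) k) * (X e ^ 3) + (36 : MvPolynomial (Fin n) k) * (X d * X e ^ 2) + (54 : MvPolynomial (Fin n) k) * (X d ^ 2 * X e) + (27 : MvPolynomial (Fin n) k) * (X d ^ 3) + (12 : MvPolynomial (Fin n) k) * (X c * X e ^ 2) + (36 : MvPolynomial (Fin n) k) * (X c * X d * X e) + (27 : MvPolynomial (Fin n) k) * (X c * X d ^ 2) + (6 : MvPolynomial (Fin n) k) * (X c ^ 2 * X e) + (9 : MvPolynomial (Fin n) k) * (X c ^ 2 * X d) + (1 : MvPolynomial (Fin n) k) * (X c ^ 3)) •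
          reesT (gens12 k n a b c d 0) (gens12_mem_I12 k n a b c d 0) +
        ((-24 : MvPolynomial (Fin n) k) * (X e ^ 2) + (-72 : MvPolynomial (Fin n) k) * (X d * X e) + (-54 : MvPolynomial (Fin n) k) * (X d ^ 2) + (-60 : MvPolynomial (Fin n) k) * (X c * X e) + (-63 : MvPolynomial (Fin n) k) * (X c * X d) + (-24 : MvPolynomial (Fin n) k) * (X c ^ 2)) •
          reesT (gens12 k n a b c d 4) (gens12_mem_I12 k n a b c d 4) +
        ((12 : MvPolynomial (Fin n) k) * (X e ^ 2) + (36 : MvPolynomial (Fin n) k) * (X d * X e) + (27 : MvPolynomial (Fin n) k) * (X d ^ 2) + (12 : MvPolynomial (Fin n) k) * (X c * X e) + (18 : MvPolynomial (Fin n) k) * (X c * X d) + (3 : MvPolynomial (Fin n) k) * (X c ^ 2) + (-12 : MvPolynomial (Fin n) k) * (X b * X e) + (-3 : MvPolynomial (Fin n) k) * (X b * X c)) •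
          reesT (gens12 k n a b c d 5) (gens12_mem_I12 k n a b c d 5) +
        ((24 : MvPolynomial (Fin n) k) * (X d * X e) + (48 : MvPolynomial (Fin n) k) * (X d ^ 2) + (6 : MvPolynomial (Fin n) k) * (X c * X e) + (21 : MvPolynomial (Fin n) k) * (X c * X d) + (3 : MvPolynomial (Fin n) k) * (X c ^ 2)) •
          reesT (gens12 k n a b c d 8) (gens12_mem_I12 k n a b c d 8) +
        ((24 : MvPolynomial (Fin n) k) * (X e) + (36 : MvPolynomial (Fin n) k) * (X d)) •
          reesT (gens12 k n a b c d 9) (gens12_mem_I12 k n a b c d 9) +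
        ((-24 : MvPolynomial (Fin n) k) * (X e) + (-36 : MvPolynomial (Fin n) k) * (X d) + (-30 : MvPolynomial (Fin n) k) * (X c)) •
          reesT (gens12 k n a b c d 10) (gens12_mem_I12 k n a b c d 10) +
        ((6 : MvPolynomial (Fin n) k) * (X e) + (9 : MvPolynomial (Fin n) k) * (X d) + (3 : MvPolynomial (Fin n) k) * (X c) + (-6 : MvPolynomial (Fin n) k) * (X b)) •
          reesT (gens12 k n a b c d 13) (gens12_mem_I12 k n a b c d 13) +
        ((-12 : MvPolynomial (Fin n) k) * (X d) + (-6 : MvPolynomial (Fin n) k) * (X c)) •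
          reesT (gens12 k n a b c d 18) (gens12_mem_I12 k n a b c d 18) +
        ((-8 : MvPolynomial (Fin n) k) * (1)) •
          reesT (gens12 k n a b c d 19) (gens12_mem_I12 k n a b c d 19) +
        ((12 : MvPolynomial (Fin n) k) * (X d) + (3 : MvPolynomial (Fin n) k) * (X c) + (-1 : MvPolynomial (Fin n) k) * (X b)) •
          reesT (gens12 k n a b c d 20) (gens12_mem_I12 k n a b c d 20) +
        ((12 : MvPolynomial (Fin n) k) * (1)) •
          reesT (gens12 k n a b c d 21) (gens12_mem_I12 k n a b c d 21) +
        ((-6 : MvPolynomial (Fin n) k) * (1)) •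
          reesT (gens12 k n a b c d 24) (gens12_mem_I12 k n a b c d 24) +
        ((-12 : MvPolynomial (Fin n) k) * (X e ^ 2)) •
          reesT (gens12 k n a b c d 34) (gens12_mem_I12 k n a b c d 34) +
        ((-12 : MvPolynomial (Fin n) k) * (X e)) •
          reesT (gens12 k n a b c d 36) (gens12_mem_I12 k n a b c d 36) +
        ((-3 : MvPolynomial (Fin n) k) * (1)) •
          reesT (gens12 k n a b c d 38) (gens12_mem_I12 k n a b c d 38)) ∈ 𝔭 :=
  (Ideal.add_mem _ (Ideal.add_mem _ (Ideal.add_mem _ (Ideal.add_mem _ (Ideal.add_mem _ (Ideal.add_mem _ (Ideal.add_mem _ (Ideal.add_mem _ (Ideal.add_mem _ (Ideal.add_mem _ (Ideal.add_mem _ (Ideal.add_mem _ (Ideal.add_mem _ (Ideal.add_mem _ (Submodule.smul_of_tower_mem _ _ (h 0 (by decide)))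
      (Submodule.smul_of_tower_mem _ _ (h 4 (by decide))))
      (Submodule.smul_of_tower_mem _ _ (h 5 (by decide))))
      (Submodule.smul_of_tower_mem _ _ (h 8 (by decide))))
      (Submodule.smul_of_tower_mem _ _ (h 9 (by decide))))
      (Submodule.smul_of_tower_mem _ _ (h 10 (by decide))))
      (Submodule.smul_of_tower_mem _ _ (h 13 (by decide))))
      (Submodule.smul_of_tower_mem _ _ (h 18 (by decide))))
      (Submodule.smul_of_tower_mem _ _ (h 19 (by decide))))
      (Submodule.smul_of_tower_mem _ _ (h 20 (by decide))))
      (Submodule.smul_of_tower_mem _ _ (h 21 (by decide))))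
      (Submodule.smul_of_tower_mem _ _ (h 24 (by decide))))
      (Submodule.smul_of_tower_mem _ _ (h 34 (by decide))))
      (Submodule.smul_of_tower_mem _ _ (h 36 (by decide))))
      (Submodule.smul_of_tower_mem _ _ (h 38 (by decide))))

/-- The `j ≠ 2` part of the `(2j₃)²` certificate lies in `𝔭` when its twenty-one sections do.
[OURS · L1 W4.5c] -/
theorem jThreeTwo_sq_rest_mem (𝔭 : Ideal (reesAlgebra (I12 k n a b c d)))
    (h : ∀ j : Fin 40, j = 1 ∨ j = 4 ∨ j = 5 ∨ j = 6 ∨ j = 7 ∨ j = 8 ∨ j = 9 ∨ j = 10 ∨ j = 11 ∨ j = 13 ∨ j = 14 ∨ j = 18 ∨ j = 20 ∨ j = 21 ∨ j = 24 ∨ j = 34 ∨ j = 35 ∨ j = 36 ∨ j = 37 ∨ j = 38 ∨ j = 39 →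
      reesT (gens12 k n a b c d j) (gens12_mem_I12 k n a b c d j) ∈ 𝔭) :
    (((36 : MvPolynomial (Fin n) k) * (X e ^ 2) + (72 : MvPolynomial (Fin n) k) * (X d * X e) + (36 : MvPolynomial (Fin n) k) * (X d ^ 2) + (12 : MvPolynomial (Fin n) k) * (X c * X e) + (12 : MvPolynomial (Fin n) k) * (X c * X d) + (1 : MvPolynomial (Fin n) k) * (X c ^ 2)) •
          reesT (gens12 k n a b c d 1) (gens12_mem_I12 k n a b c d 1) +
        ((-108 : MvPolynomial (Fin n) k) * (X d * X e) + (-108 : MvPolynomial (Fin n) k) * (X d ^ 2) + (144 : MvPolynomial (Fin n) k) * (X c * X e) + (-18 : MvPolynomial (Fin n) k) * (X c * X d) + (-24 : MvPolynomial (Fin n) k) * (X c ^ 2) + (72 : MvPolynomial (Fin n) k) * (X b * X e) + (36 : MvPolynomial (Fin n) k) * (X b * X d) + (12 : MvPolynomial (Fin n) k) * (X b * X c)) •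
          reesT (gens12 k n a b c d 4) (gens12_mem_I12 k n a b c d 4) +
        ((144 : MvPolynomial (Fin n) k) * (X e ^ 2) + (36 : MvPolynomial (Fin n) k) * (X d ^ 2) + (-48 : MvPolynomial (Fin n) k) * (X c * X e) + (4 : MvPolynomial (Fin n) k) * (X c ^ 2) + (-4 : MvPolynomial (Fin n) k) * (X b * X c) + (1 : MvPolynomial (Fin n) k) * (X b ^ 2)) •
          reesT (gens12 k n a b c d 5) (gens12_mem_I12 k n a b c d 5) +
        ((-216 : MvPolynomial (Fin n) k) * (X e)) •
          reesT (gens12 k n a b c d 6) (gens12_mem_I12 k n a b c d 6) +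
        ((81 : MvPolynomial (Fin n) k) * (1)) •
          reesT (gens12 k n a b c d 7) (gens12_mem_I12 k n a b c d 7) +
        ((-144 : MvPolynomial (Fin n) k) * (X e ^ 2) + (-72 : MvPolynomial (Fin n) k) * (X d * X e) + (90 : MvPolynomial (Fin n) k) * (X d ^ 2) + (36 : MvPolynomial (Fin n) k) * (X c * X e) + (72 : MvPolynomial (Fin n) k) * (X c * X d) + (10 : MvPolynomial (Fin n) k) * (X c ^ 2) + (-24 : MvPolynomial (Fin n) k) * (X b * X e) + (-24 : MvPolynomial (Fin n) k) * (X b * X d) + (-2 : MvPolynomial (Fin n) k) * (X b * X c) + (12 : MvPolynomial (Fin n) k) * (X a * X e)) •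
          reesT (gens12 k n a b c d 8) (gens12_mem_I12 k n a b c d 8) +
        ((108 : MvPolynomial (Fin n) k) * (X e) + (108 : MvPolynomial (Fin n) k) * (X d) + (-72 : MvPolynomial (Fin n) k) * (X b)) •
          reesT (gens12 k n a b c d 9) (gens12_mem_I12 k n a b c d 9) +
        ((144 : MvPolynomial (Fin n) k) * (X e) + (-54 : MvPolynomial (Fin n) k) * (X d) + (-48 : MvPolynomial (Fin n) k) * (X c)) •
          reesT (gens12 k n a b c d 10) (gens12_mem_I12 k n a b c d 10) +
        ((-108 : MvPolynomial (Fin n) k) * (1)) •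
          reesT (gens12 k n a b c d 11) (gens12_mem_I12 k n a b c d 11) +
        ((-48 : MvPolynomial (Fin n) k) * (X e) + (8 : MvPolynomial (Fin n) k) * (X c) + (-16 : MvPolynomial (Fin n) k) * (X b)) •
          reesT (gens12 k n a b c d 13) (gens12_mem_I12 k n a b c d 13) +
        ((36 : MvPolynomial (Fin n) k) * (1)) •
          reesT (gens12 k n a b c d 14) (gens12_mem_I12 k n a b c d 14) +
        ((-72 : MvPolynomial (Fin n) k) * (X e) + (-72 : MvPolynomial (Fin n) k) * (X d) + (-48 : MvPolynomial (Fin n) k) * (X c)) •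
          reesT (gens12 k n a b c d 18) (gens12_mem_I12 k n a b c d 18) +
        ((24 : MvPolynomial (Fin n) k) * (X e) + (60 : MvPolynomial (Fin n) k) * (X d) + (13 : MvPolynomial (Fin n) k) * (X c) + (-6 : MvPolynomial (Fin n) k) * (X b)) •
          reesT (gens12 k n a b c d 20) (gens12_mem_I12 k n a b c d 20) +
        ((36 : MvPolynomial (Fin n) k) * (1)) •
          reesT (gens12 k n a b c d 21) (gens12_mem_I12 k n a b c d 21) +
        ((-24 : MvPolynomial (Fin n) k) * (1)) •
          reesT (gens12 k n a b c d 24) (gens12_mem_I12 k n a b c d 24) +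
        ((144 : MvPolynomial (Fin n) k) * (X e ^ 2)) •
          reesT (gens12 k n a b c d 34) (gens12_mem_I12 k n a b c d 34) +
        ((-72 : MvPolynomial (Fin n) k) * (X e ^ 2) + (-144 : MvPolynomial (Fin n) k) * (X d * X e)) •
          reesT (gens12 k n a b c d 35) (gens12_mem_I12 k n a b c d 35) +
        ((48 : MvPolynomial (Fin n) k) * (X e)) •
          reesT (gens12 k n a b c d 36) (gens12_mem_I12 k n a b c d 36) +
        ((-36 : MvPolynomial (Fin n) k) * (X e)) •
          reesT (gens12 k n a b c d 37) (gens12_mem_I12 k n a b c d 37) +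
        ((-12 : MvPolynomial (Fin n) k) * (1)) •
          reesT (gens12 k n a b c d 38) (gens12_mem_I12 k n a b c d 38) +
        ((36 : MvPolynomial (Fin n) k) * (X e ^ 2)) •
          reesT (gens12 k n a b c d 39) (gens12_mem_I12 k n a b c d 39)) ∈ 𝔭 :=
  (Ideal.add_mem _ (Ideal.add_mem _ (Ideal.add_mem _ (Ideal.add_mem _ (Ideal.add_mem _ (Ideal.add_mem _ (Ideal.add_mem _ (Ideal.add_mem _ (Ideal.add_mem _ (Ideal.add_mem _ (Ideal.add_mem _ (Ideal.add_mem _ (Ideal.add_mem _ (Ideal.add_mem _ (Ideal.add_mem _ (Ideal.add_mem _ (Ideal.add_mem _ (Ideal.add_mem _ (Ideal.add_mem _ (Ideal.add_mem _ (Submodule.smul_of_tower_mem _ _ (h 1 (by decide)))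
      (Submodule.smul_of_tower_mem _ _ (h 4 (by decide))))
      (Submodule.smul_of_tower_mem _ _ (h 5 (by decide))))
      (Submodule.smul_of_tower_mem _ _ (h 6 (by decide))))
      (Submodule.smul_of_tower_mem _ _ (h 7 (by decide))))
      (Submodule.smul_of_tower_mem _ _ (h 8 (by decide))))
      (Submodule.smul_of_tower_mem _ _ (h 9 (by decide))))
      (Submodule.smul_of_tower_mem _ _ (h 10 (by decide))))
      (Submodule.smul_of_tower_mem _ _ (h 11 (by decide))))
      (Submodule.smul_of_tower_mem _ _ (h 13 (by decide))))
      (Submodule.smul_of_tower_mem _ _ (h 14 (by decide))))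
      (Submodule.smul_of_tower_mem _ _ (h 18 (by decide))))
      (Submodule.smul_of_tower_mem _ _ (h 20 (by decide))))
      (Submodule.smul_of_tower_mem _ _ (h 21 (by decide))))
      (Submodule.smul_of_tower_mem _ _ (h 24 (by decide))))
      (Submodule.smul_of_tower_mem _ _ (h 34 (by decide))))
      (Submodule.smul_of_tower_mem _ _ (h 35 (by decide))))
      (Submodule.smul_of_tower_mem _ _ (h 36 (by decide))))
      (Submodule.smul_of_tower_mem _ _ (h 37 (by decide))))
      (Submodule.smul_of_tower_mem _ _ (h 38 (by decide))))
      (Submodule.smul_of_tower_mem _ _ (h 39 (by decide))))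

/-- **`i₂³t ∈ 𝔭`** when `g_j t ∈ 𝔭` for all sixteen indices of the certificate (e.g. off the charts
`j ≠ 1`). [OURS · L1 W4.5c] -/
theorem reesT_iTwo_cube_mem_of_reesT_mem (𝔭 : Ideal (reesAlgebra (I12 k n a b c d)))
    (h : ∀ j : Fin 40, j = 0 ∨ j = 2 ∨ j = 4 ∨ j = 5 ∨ j = 8 ∨ j = 9 ∨ j = 10 ∨ j = 13 ∨ j = 18 ∨ j = 19 ∨ j = 20 ∨ j = 21 ∨ j = 24 ∨ j = 34 ∨ j = 36 ∨ j = 38 →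
      reesT (gens12 k n a b c d j) (gens12_mem_I12 k n a b c d j) ∈ 𝔭) :
    reesT (iTwo k n a b c d e ^ 3) (iTwo_cube_mem_I12 k n a b c d e) ∈ 𝔭 := by
  rw [reesT_iTwo_cube_eq]
  refine 𝔭.add_mem (h 2 (by decide)) (iTwo_cube_rest_mem k n a b c d e 𝔭 fun j hj => h j ?_)
  rcases hj with rfl | rfl | rfl | rfl | rfl | rfl | rfl | rfl | rfl | rfl | rfl | rfl | rfl | rfl | rfl <;> decide

/-- **`(2j₃)²t ∈ 𝔭`** when `g_j t ∈ 𝔭` for all twenty-two indices (e.g. off the charts `j ≠ 0`).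
[OURS · L1 W4.5c] -/
theorem reesT_jThreeTwo_sq_mem_of_reesT_mem (𝔭 : Ideal (reesAlgebra (I12 k n a b c d)))
    (h : ∀ j : Fin 40, j = 1 ∨ j = 2 ∨ j = 4 ∨ j = 5 ∨ j = 6 ∨ j = 7 ∨ j = 8 ∨ j = 9 ∨ j = 10 ∨ j = 11 ∨ j = 13 ∨ j = 14 ∨ j = 18 ∨ j = 20 ∨ j = 21 ∨ j = 24 ∨ j = 34 ∨ j = 35 ∨ j = 36 ∨ j = 37 ∨ j = 38 ∨ j = 39 →
      reesT (gens12 k n a b c d j) (gens12_mem_I12 k n a b c d j) ∈ 𝔭) :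
    reesT (jThreeTwo k n a b c d e ^ 2) (jThreeTwo_sq_mem_I12 k n a b c d e) ∈ 𝔭 := by
  rw [reesT_jThreeTwo_sq_eq]
  refine 𝔭.add_mem (Submodule.smul_of_tower_mem _ _ (h 2 (by decide)))
    (jThreeTwo_sq_rest_mem k n a b c d e 𝔭 fun j hj => h j ?_)
  rcases hj with rfl | rfl | rfl | rfl | rfl | rfl | rfl | rfl | rfl | rfl | rfl | rfl | rfl | rfl | rfl | rfl | rfl | rfl | rfl | rfl | rfl <;> decide

/-- **`i₂³t ≡ x_c⁶t`**: if the fifteen sections `g_j t` (`j ≠ 2`) of the certificate and `i₂³t` lie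
in `𝔭`, so does `x_c⁶t`. [OURS · L1 W4.5c] -/
theorem reesT_two_mem_of_iTwo_cube_mem (𝔭 : Ideal (reesAlgebra (I12 k n a b c d)))
    (h : ∀ j : Fin 40, j = 0 ∨ j = 4 ∨ j = 5 ∨ j = 8 ∨ j = 9 ∨ j = 10 ∨ j = 13 ∨ j = 18 ∨ j = 19 ∨ j = 20 ∨ j = 21 ∨ j = 24 ∨ j = 34 ∨ j = 36 ∨ j = 38 →
      reesT (gens12 k n a b c d j) (gens12_mem_I12 k n a b c d j) ∈ 𝔭)
    (hi : reesT (iTwo k n a b c d e ^ 3) (iTwo_cube_mem_I12 k n a b c d e) ∈ 𝔭) :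
    reesT (gens12 k n a b c d 2) (gens12_mem_I12 k n a b c d 2) ∈ 𝔭 := by
  rw [reesT_iTwo_cube_eq] at hi
  exact (Ideal.add_mem_iff_left _ (iTwo_cube_rest_mem k n a b c d e 𝔭 h)).mp hi

/-- **`(2j₃)²t ≡ 4·x_c⁶t`**: in characteristic `≠ 2`, if the twenty-one sections `g_j t` (`j ≠ 2`)
and `(2j₃)²t` lie in `𝔭`, so does `x_c⁶t`. [OURS · L1 W4.5c] -/
theorem reesT_two_mem_of_jThreeTwo_sq_mem (h2 : (2 : k) ≠ 0)
    (𝔭 : Ideal (reesAlgebra (I12 k n a b c d)))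
    (h : ∀ j : Fin 40, j = 1 ∨ j = 4 ∨ j = 5 ∨ j = 6 ∨ j = 7 ∨ j = 8 ∨ j = 9 ∨ j = 10 ∨ j = 11 ∨ j = 13 ∨ j = 14 ∨ j = 18 ∨ j = 20 ∨ j = 21 ∨ j = 24 ∨ j = 34 ∨ j = 35 ∨ j = 36 ∨ j = 37 ∨ j = 38 ∨ j = 39 →
      reesT (gens12 k n a b c d j) (gens12_mem_I12 k n a b c d j) ∈ 𝔭)
    (hj : reesT (jThreeTwo k n a b c d e ^ 2) (jThreeTwo_sq_mem_I12 k n a b c d e) ∈ 𝔭) :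
    reesT (gens12 k n a b c d 2) (gens12_mem_I12 k n a b c d 2) ∈ 𝔭 := by
  rw [reesT_jThreeTwo_sq_eq] at hj
  have h4 := (Ideal.add_mem_iff_left _ (jThreeTwo_sq_rest_mem k n a b c d e 𝔭 h)).mp hj
  rw [Algebra.smul_def] at h4
  have hu : IsUnit (algebraMap (MvPolynomial (Fin n) k) (reesAlgebra (I12 k n a b c d))
      (4 : MvPolynomial (Fin n) k)) := by
    refine IsUnit.map _ ?_
    have h4k : IsUnit (4 : k) := by
      rw [show (4 : k) = 2 * 2 by norm_num]
      exact (isUnit_iff_ne_zero.mpr h2).mul (isUnit_iff_ne_zero.mpr h2)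
    rw [show (4 : MvPolynomial (Fin n) k) = MvPolynomial.C 4 from
      (map_ofNat (MvPolynomial.C : k →+* MvPolynomial (Fin n) k) 4).symm]
    exact h4k.map _
  exact (Ideal.unit_mul_mem_iff_mem 𝔭 hu).mp h4

/-! ## The loci -/

/-- If `i₂³t ∈ 𝔭_v` or `(2j₃)²t ∈ 𝔭_v` then `v ∉ chartW₂ = D₊(i₂³t · (2j₃)²t)`. [OURS · L1 W4.5c] -/
theorem not_mem_chartW₂_of_mem (v : affineBlowup (I12 k n a b c d))
    (hv : reesT (iTwo k n a b c d e ^ 3) (iTwo_cube_mem_I12 k n a b c d e) ∈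
        v.asHomogeneousIdeal.toIdeal ∨
      reesT (jThreeTwo k n a b c d e ^ 2) (jThreeTwo_sq_mem_I12 k n a b c d e) ∈
        v.asHomogeneousIdeal.toIdeal) :
    v ∉ chartW₂ k n a b c d e := by
  intro h
  rw [chartW₂_def] at h
  refine (Proj.mem_basicOpen _ _ _).mp h ?_
  rcases hv with hv | hv
  · exact v.asHomogeneousIdeal.toIdeal.mul_mem_right _ hv
  · exact v.asHomogeneousIdeal.toIdeal.mul_mem_left _ hv

/-- **Brick `HB₂` of the J₅ toric exit** (`stubs/J5Bricks.lean` l.117 VERBATIM at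
`W₂ := chartW₂ k n a b c d e`): the `μ₃`-vertex curve `C_b = Fix ∖ ⋃_{j ≠ 1} V[g_j]` misses
`chartW₂` — the `i₂³` certificate uses no `g₁`. [OURS · L1 W4.5c] [folklore] -/
theorem disjoint_vertexCurve_one_chartW₂ :
    Disjoint (vertexCurve k n a b c d 1)
      (chartW₂ k n a b c d e : Set (affineBlowup (I12 k n a b c d))) := by
  rw [Set.disjoint_left]
  rintro v ⟨-, hv⟩ hvW
  refine not_mem_chartW₂_of_mem k n a b c d e v (Or.inl
    (reesT_iTwo_cube_mem_of_reesT_mem k n a b c d e _ fun j hj => ?_)) hvW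
  have hj' : j ≠ 1 := by
    rcases hj with rfl | rfl | rfl | rfl | rfl | rfl | rfl | rfl | rfl | rfl | rfl | rfl | rfl | rfl | rfl | rfl <;> decide
  refine reesT_gens12_mem_of_not_mem_chart k n a b c d j v fun h => hv ?_
  exact Opens.mem_iSup.mpr ⟨⟨j, hj'⟩, h⟩

/-- **Brick `HA₂` of the J₅ toric exit** (`stubs/J5Bricks.lean` l.118 VERBATIM at
`W₂ := chartW₂ k n a b c d e`): the `μ₄`-vertex curve `C_a = Fix ∖ ⋃_{j ≠ 0} V[g_j]` misses
`chartW₂` — the `(2j₃)²` certificate uses no `g₀`. [OURS · L1 W4.5c] [folklore] -/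
theorem disjoint_vertexCurve_zero_chartW₂ :
    Disjoint (vertexCurve k n a b c d 0)
      (chartW₂ k n a b c d e : Set (affineBlowup (I12 k n a b c d))) := by
  rw [Set.disjoint_left]
  rintro v ⟨-, hv⟩ hvW
  refine not_mem_chartW₂_of_mem k n a b c d e v (Or.inr
    (reesT_jThreeTwo_sq_mem_of_reesT_mem k n a b c d e _ fun j hj => ?_)) hvW
  have hj' : j ≠ 0 := by
    rcases hj with rfl | rfl | rfl | rfl | rfl | rfl | rfl | rfl | rfl | rfl | rfl | rfl | rfl | rfl | rfl | rfl | rfl | rfl | rfl | rfl | rfl | rfl <;> decide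
  refine reesT_gens12_mem_of_not_mem_chart k n a b c d j v fun h => hv ?_
  exact Opens.mem_iSup.mpr ⟨⟨j, hj'⟩, h⟩

/-- **`C_c ⊆ W₂`** (idea-2 W2-DESIGN §4, characteristic `≠ 2`): a point of the `μ₂`-vertex curve
`C_c = Fix ∖ ⋃_{j ≠ 2} V[g_j]` lies in `V[x_c⁶]` (the four vertex charts cover), so `x_c⁶t ∉ 𝔭_v`,
while every other `g_j t` lies in `𝔭_v`; hence `i₂³t ≡ x_c⁶t` and `(2j₃)²t ≡ 4x_c⁶t` are not in
`𝔭_v`, i.e. `v ∈ D₊(i₂³t · (2j₃)²t)`. [OURS · L1 W4.5c] [folklore] -/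
theorem vertexCurve_two_subset_chartW₂ (h2 : (2 : k) ≠ 0) :
    vertexCurve k n a b c d 2 ⊆ (chartW₂ k n a b c d e : Set (affineBlowup (I12 k n a b c d))) := by
  rintro v ⟨-, hv⟩
  have h𝔭 : v.asHomogeneousIdeal.toIdeal.IsPrime := v.isPrime
  have hoff : ∀ j : Fin 40, j ≠ 2 →
      reesT (gens12 k n a b c d j) (gens12_mem_I12 k n a b c d j) ∈ v.asHomogeneousIdeal.toIdeal :=
    fun j hj => reesT_gens12_mem_of_not_mem_chart k n a b c d j v fun h =>
      hv (Opens.mem_iSup.mpr ⟨⟨j, hj⟩, h⟩)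
  -- `v ∈ chart 2` by the vertex cover
  have hv2 : v ∈ chart k n a b c d 2 := by
    have htop : v ∈ (⊤ : (affineBlowup (I12 k n a b c d)).Opens) := trivial
    rw [← iSup_vertexCharts_eq_top k n a b c d] at htop
    simp only [Opens.mem_sup] at htop
    rcases htop with ((h0 | h1) | h2') | h3
    · exact absurd h0 fun h => hv (Opens.mem_iSup.mpr ⟨⟨0, by decide⟩, h⟩)
    · exact absurd h1 fun h => hv (Opens.mem_iSup.mpr ⟨⟨1, by decide⟩, h⟩)
    · exact h2'
    · exact absurd h3 fun h => hv (Opens.mem_iSup.mpr ⟨⟨3, by decide⟩, h⟩)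
  have k2 : reesT (gens12 k n a b c d 2) (gens12_mem_I12 k n a b c d 2) ∉ v.asHomogeneousIdeal.toIdeal := fun h =>
    (Proj.mem_basicOpen _ _ _).mp ((chart_eq_basicOpen k n a b c d 2) ▸ hv2) h
  rw [chartW₂_def]
  refine (Proj.mem_basicOpen _ _ _).mpr fun hprod => ?_
  rcases h𝔭.mem_or_mem hprod with hi | hj
  · exact k2 (reesT_two_mem_of_iTwo_cube_mem k n a b c d e _ (fun j hj => hoff j (by
      rcases hj with rfl | rfl | rfl | rfl | rfl | rfl | rfl | rfl | rfl | rfl | rfl | rfl | rfl | rfl | rfl <;> decide)) hi)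
  · exact k2 (reesT_two_mem_of_jThreeTwo_sq_mem k n a b c d e h2 _ (fun j hj => hoff j (by
      rcases hj with rfl | rfl | rfl | rfl | rfl | rfl | rfl | rfl | rfl | rfl | rfl | rfl | rfl | rfl | rfl | rfl | rfl | rfl | rfl | rfl | rfl <;> decide)) hj)

end Summit.ResolutionOfSingularities.ResolutionOfSingularities.Theorems.WildQuotientResolution.JordanFive

end
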